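import Literature.Probability.RandomPlanarGeometry.JordanIndexOne
import HarnessLib

/-!
# Winding number of a reparametrised boundary loop

Topic: Probability / RandomPlanarGeometry. A complement to `index_eq_mul_index`
(`JordanIndexOne.lean`): for a Jordan domain `D`, a continuous `σ : [0, 1] → ℝ` with
`σ 1 = σ 0 + n` (`n ∈ ℤ`) and a point `z` off the boundary curve, the loop `t ↦ D.boundary (σ t)`
has winding number `n · D.index z` about `z` (`wind_boundary_comp_eq_mul_index`): a logarithm `L`
of `D.boundary - z` along `ℝ` satisfies `L (s + 1) = L s + 2πi · D.index z`, and `L ∘ σ` is a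
logarithm of the reparametrised loop. Folklore (covering-space bookkeeping, cf. Ahlfors,
*Complex Analysis*, §4.2.1); the proof is that of `index_eq_mul_index` verbatim.

Mathlib / tree: `hasLogOn_univ`, `exists_int_eq_add_of_exp_eq`, `wind_spec`,
`int_eq_of_mul_two_pi_I_eq` (`WindingNumber.lean`, `LoopWinding.lean`), `JordanDomain.index`.
-/

noncomputable section

open Set Complex Filter Topology Literature.Topology.PlaneTopology

namespace Literature.Probability.RandomPlanarGeometry.JordanDomain

/-- **The winding number of a reparametrised boundary loop**: if `σ` is continuous on `[0, 1]`
with `σ 1 = σ 0 + n`, then `t ↦ D.boundary (σ t)` winds `n · D.index z` times about every point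
`z` off the boundary curve. [folklore] -/
theorem wind_boundary_comp_eq_mul_index (D : JordanDomain) {σ : ℝ → ℝ} (hσc : ContinuousOn σ (Icc 0 1))
    {n : ℤ} (hn : σ 1 = σ 0 + n) {z : ℂ} (hz : z ∉ frontier D.carrier) :
    wind (fun t => D.boundary (σ t) - z) = n * D.index z := by
  set f : ℝ → ℂ := fun s => D.boundary s - z with hf
  have hfc : Continuous f := D.continuous_boundary.sub continuous_const
  have hfne : ∀ s, f s ≠ 0 := D.boundary_sub_ne_zero hz
  obtain ⟨L, hLc, hLe⟩ := hasLogOn_univ isSimplyConnected_univ_real hfc hfne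
  have hLc' : Continuous L := continuousOn_univ.1 hLc
  -- the shift by one period adds `2πi N`
  obtain ⟨N, hN⟩ : ∃ N : ℤ, ∀ s, L (s + 1) = L s + N * (2 * Real.pi * I) := by
    obtain ⟨N, hN⟩ := exists_int_eq_add_of_exp_eq isPreconnected_univ
      (hLc'.comp (continuous_id.add continuous_const)).continuousOn hLc
      (fun s _ => by
        show exp (L (s + 1)) = exp (L s)
        rw [hLe _ (mem_univ _), hLe _ (mem_univ _), hf]
        simp only
        rw [D.periodic_boundary])
    exact ⟨N, fun s => hN s (mem_univ _)⟩
  have hNw : N = D.index z := by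
    have h := wind_spec (f := f) (l := L) hLc'.continuousOn (fun t _ => hLe t (mem_univ _))
      (by show D.boundary 0 - z = D.boundary 1 - z; rw [← D.periodic_boundary 0, zero_add])
    have h1 := hN 0
    rw [zero_add] at h1
    apply int_eq_of_mul_two_pi_I_eq
    have : L 1 - L 0 = N * (2 * Real.pi * I) := by rw [h1]; ring
    rw [← this, h]
    rfl
  -- shifting by `m` periods
  have hshiftN : ∀ (m : ℕ) (s : ℝ), L (s + m) = L s + m * N * (2 * Real.pi * I) := by
    intro m
    induction m with
    | zero => intro s; simp
    | succ m ih =>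
      intro s
      have e : s + ((m + 1 : ℕ) : ℝ) = (s + m) + 1 := by push_cast; ring
      rw [e, hN, ih]; push_cast; ring
  have hshift : ∀ (m : ℤ) (s : ℝ), L (s + m) = L s + m * N * (2 * Real.pi * I) := by
    intro m s
    obtain ⟨j, rfl | rfl⟩ := m.eq_nat_or_neg
    · have := hshiftN j s
      push_cast at this ⊢
      exact this
    · have := hshiftN j (s + ((-(j : ℤ) : ℤ) : ℝ))
      have e : s + ((-(j : ℤ) : ℤ) : ℝ) + (j : ℝ) = s := by push_cast; ring
      rw [e] at this
      push_cast at this ⊢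
      linear_combination -this
  -- `L ∘ σ` is a logarithm of the reparametrised loop on `[0, 1]`
  have h1 := wind_spec (f := fun t => D.boundary (σ t) - z) (l := fun t => L (σ t))
    (hLc'.comp_continuousOn hσc) (fun t _ => by
      show exp (L (σ t)) = D.boundary (σ t) - z
      rw [hLe _ (mem_univ _), hf])
    (by
      show D.boundary (σ 0) - z = D.boundary (σ 1) - z
      have := (D.periodic_boundary.int_mul n) (σ 0)
      rw [mul_one] at this
      rw [hn, this])
  have h2 : L (σ 1) - L (σ 0) = (n * N : ℤ) * (2 * Real.pi * I) := by
    rw [hn, hshift n (σ 0)]; push_cast; ring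
  have h3 := int_eq_of_mul_two_pi_I_eq (h2.symm.trans h1)
  rw [← h3, hNw]

/-- **The boundary traversed from `σ₀` once forward winds `D.index z` times**, once backward
`-D.index z` times: the loop `t ↦ D.boundary (σ₀ + t s)` with `s = ±1`. [folklore] -/
theorem wind_boundary_linear (D : JordanDomain) (σ₀ : ℝ) {n : ℤ} {z : ℂ} (hz : z ∉ frontier D.carrier) :
    wind (fun t => D.boundary (σ₀ + t * n) - z) = n * D.index z :=
  D.wind_boundary_comp_eq_mul_index (by fun_prop) (by simp) hz

end Literature.Probability.RandomPlanarGeometry.JordanDomain
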